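import Literature.Analysis.FluidPDE.AnomalousDissipationTwoHalfD
import Literature.Analysis.FluidPDE.TwoHalfWeakLimits
import Literature.Analysis.FluidPDE.BrueDeLellisAnomalousDissipation
import Literature.Analysis.FluidPDE.PassiveScalarClassicalEnergy
import Literature.Analysis.FunctionSpaces.ContDiffHolderAlgebra
import HarnessLib

/-!
# Bruè–De Lellis 2023: Theorem 3.1 (planar) implies Theorem 1.1 (on `T³`)

Topic `Analysis/FluidPDE`, theorems only (no new definition, no named fact). The source
(E. Bruè, C. De Lellis, Comm. Math. Phys. 400 (2023) = arXiv:2207.06301v1, §3.1 p. 6) introduces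
Theorem 3.1 as the "more precise version" of Theorem 1.1: the `T³` objects of Theorem 1.1 are the
`2½`-dimensional lifts (3.1) `u = (v, θ) ∘ π`, `p = q ∘ π`, `f = (g, 0) ∘ π` of the planar objects of
Theorem 3.1. This file proves exactly that implication between the two VENDORED statements,

  `BrueDeLellis2023_thm31 → brue_deLellis_anomalous_dissipation`
  (`brue_deLellis_anomalous_dissipation_of_thm31`),

from the tree's `2½`-dimensional packaging `Torus.isClassicalNSSolutionOn_twoHalf`
(`TwoHalfNavierStokes.lean`): the lifted force of the ansatz is `(g, 0) ∘ π` because `v` solves the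
planar Navier–Stokes system with force `g` and `θ` the advection–diffusion equation exactly; the force
bounds (1.2) on `T³` follow from the planar convergence `g^{ν_m} → g` in `C([0,1]; C^α(T²))`
(Theorem 3.1 (1)) — a convergent sequence of `C([0,1]; C^{0,α})` fields is uniformly bounded
(`ContinuousInHolderOn.holderUniformlyBoundedOn_holds` for the limit and for the finitely many leading
terms, `BrueDeLellis2023.continuousInHolderOn_of_isSmoothSpaceTimeOn` for smooth fields) — and
`‖(G,0)∘π‖_{C^{0,α}(T³)} ≤ ‖G‖_{C^{0,α}(T²)}` (`Torus.eBoundedHolderNorm_twoHalf_zero_right_le`); the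
exponent `α = 0` allowed by the `T³` statement is served by `α = 1/2` and
`‖·‖_{C^{0,0}} ≤ 3‖·‖_{C^{0,1/2}}`; and the anomalous dissipation (1.3) follows from (3.4) since
`‖∇u‖²_{L²(T³)} = ‖∇v‖²_{L²(T²)} + ‖∇θ‖²_{L²(T²)} ≥ ‖∇θ‖²` (`Torus.gradNormSq_twoHalf`).

Consequently `BrueDeLellis2023_thm31` inherits every proof of `brue_deLellis_anomalous_dissipation`'s
hypotheses-free consequences, and conversely nothing proved here discharges either fact.

## References

* E. Bruè, C. De Lellis, Comm. Math. Phys. 400 (2023) 1507–1533, arXiv:2207.06301v1: Thm. 1.1 p. 3,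
  §3.1 (3.1)–(3.4) and Thm. 3.1 p. 6. [`BrueDeLellisCMP2023`]
-/

open MeasureTheory Set Filter
open _root_.Topology
open scoped NNReal ENNReal InnerProductSpace

noncomputable section

namespace Literature.Analysis.FluidPDE

namespace BrueDeLellis2023

open Literature.Analysis.FunctionSpaces
open Literature.Analysis.FunctionSpaces.Torus (twoHalf planarProj)

/-- The notion of classical Navier–Stokes solution on `S × T³` only depends on the values of the
force on `S × T³`. [folklore] -/
private theorem isClassicalNSSolutionOn_congr_force_Icc {S : Set ℝ} {ν : ℝ} {f g u : ℝ → T3 → R3}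
    {p : ℝ → T3 → ℝ} (h : Torus.IsClassicalNSSolutionOn S ν f u p)
    (hfg : ∀ t ∈ S, ∀ x, f t x = g t x) : Torus.IsClassicalNSSolutionOn S ν g u p where
  smooth_velocity := h.smooth_velocity
  smooth_pressure := h.smooth_pressure
  momentum t ht x := by
    rw [← hfg t ht x]
    exact h.momentum t ht x
  divFree := h.divFree

/-- A sequence of time-dependent fields converging in `C(S; C^{0,β})` to a limit that is continuous in
the `C^{0,β}` norm on a compact `S`, each term being itself continuous in that norm, is uniformly
bounded in `C^{0,β}` over all terms and times. [folklore] -/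
private theorem exists_uniform_holder_bound_of_tendsto {X Y : Type*} [MetricSpace X] [NormedAddCommGroup Y]
    [NormedSpace ℝ Y] {S : Set ℝ} (hS : IsCompact S) {β : ℝ≥0}
    {g : ℕ → ℝ → X → Y} {gLim : ℝ → X → Y}
    (hcont : ContinuousInHolderOn S β gLim) (hm : ∀ m, ContinuousInHolderOn S β (g m))
    (htend : Tendsto (fun m => ⨆ t ∈ S, eBoundedHolderNorm β (g m t - gLim t)) atTop (𝓝 0)) :
    ∃ C : ℝ≥0∞, C < ∞ ∧ ∀ m, ∀ t ∈ S, eBoundedHolderNorm β (g m t) ≤ C := by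
  classical
  have hB : (⨆ t ∈ S, eBoundedHolderNorm β (gLim t)) < ∞ :=
    ContinuousInHolderOn.holderUniformlyBoundedOn_holds hcont hS
  have hBm : ∀ m, (⨆ t ∈ S, eBoundedHolderNorm β (g m t)) < ∞ := fun m =>
    ContinuousInHolderOn.holderUniformlyBoundedOn_holds (hm m) hS
  have hev1 : ∀ᶠ m in atTop, (⨆ t ∈ S, eBoundedHolderNorm β (g m t - gLim t)) ≤ 1 :=
    (htend.eventually (gt_mem_nhds zero_lt_one)).mono fun m hm => hm.le
  obtain ⟨M, hM⟩ := eventually_atTop.1 hev1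
  set B : ℝ≥0∞ := ⨆ t ∈ S, eBoundedHolderNorm β (gLim t) with hBdef
  set Bm : ℕ → ℝ≥0∞ := fun m => ⨆ t ∈ S, eBoundedHolderNorm β (g m t) with hBmdef
  refine ⟨B + 1 + ∑ m ∈ Finset.range M, Bm m, ?_, fun m t ht => ?_⟩
  · have h1 : B + 1 < ∞ := ENNReal.add_lt_top.2 ⟨hB, ENNReal.one_lt_top⟩
    have h2 : ∑ m ∈ Finset.range M, Bm m < ∞ := ENNReal.sum_lt_top.2 fun m _ => hBm m
    exact ENNReal.add_lt_top.2 ⟨h1, h2⟩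
  · by_cases hmM : M ≤ m
    · have hdiff : eBoundedHolderNorm β (g m t - gLim t) ≤ 1 :=
        (le_iSup₂ (f := fun t (_ : t ∈ S) => eBoundedHolderNorm β (g m t - gLim t)) t ht).trans (hM m hmM)
      have hglim : eBoundedHolderNorm β (gLim t) ≤ B :=
        le_iSup₂ (f := fun t (_ : t ∈ S) => eBoundedHolderNorm β (gLim t)) t ht
      have hsplit : gLim t + (g m t - gLim t) = g m t := add_sub_cancel (gLim t) (g m t)
      calc eBoundedHolderNorm β (g m t)
          = eBoundedHolderNorm β (gLim t + (g m t - gLim t)) := by rw [hsplit]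
        _ ≤ eBoundedHolderNorm β (gLim t) + eBoundedHolderNorm β (g m t - gLim t) :=
          eBoundedHolderNorm_add_le _ _
        _ ≤ B + 1 := add_le_add hglim hdiff
        _ ≤ B + 1 + ∑ m ∈ Finset.range M, Bm m := le_self_add
    · have hlt : m < M := lt_of_not_ge hmM
      calc eBoundedHolderNorm β (g m t)
          ≤ Bm m := le_iSup₂ (f := fun t (_ : t ∈ S) => eBoundedHolderNorm β (g m t)) t ht
        _ ≤ ∑ m ∈ Finset.range M, Bm m :=
          Finset.single_le_sum (f := Bm) (fun _ _ => zero_le) (Finset.mem_range.2 hlt)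
        _ ≤ B + 1 + ∑ m ∈ Finset.range M, Bm m := le_add_self

/-- `‖G‖_{C^{0,0}} ≤ 3 ‖G‖_{C^{0,r}}`: the `0`-Hölder seminorm (the oscillation) is at most twice the sup
norm. [folklore] -/
private theorem eBoundedHolderNorm_zero_le_three_mul {X Y : Type*} [PseudoEMetricSpace X]
    [NormedAddCommGroup Y] (r : ℝ≥0) (G : X → Y) :
    eBoundedHolderNorm 0 G ≤ 3 * eBoundedHolderNorm r G := by
  calc eBoundedHolderNorm 0 G = eSupNorm G + eHolderNorm 0 G := rfl
    _ ≤ eSupNorm G + 2 * eSupNorm G := add_le_add le_rfl (eHolderNorm_zero_le_two_mul_eSupNorm G)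
    _ = 3 * eSupNorm G := by ring
    _ ≤ 3 * eBoundedHolderNorm r G := by
      gcongr
      exact le_self_add

/-- **Theorem 3.1 ⇒ Theorem 1.1** (Bruè–De Lellis 2023, §3.1 p. 6: "We will now state more precise
versions of Theorem 1.1 and Theorem 1.2" — the `T³` solutions are the `2½`-dimensional lifts (3.1)
of the planar ones). From the witnesses of `BrueDeLellis2023_thm31` — `ν_m ↓ 0`, planar forces `g_m`,
data `v₀, θ₀`, classical planar Navier–Stokes solutions `(v_m, q_m)` and transported scalars `θ_m` —
the lifts `u_m = (v_m, θ_m) ∘ π`, `p_m = q_m ∘ π`, `f_m = (g_m, 0) ∘ π`, `u₀ = (v₀, θ₀) ∘ π` witness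
`brue_deLellis_anomalous_dissipation`: Navier–Stokes on `[0,1] × T³` by
`Torus.isClassicalNSSolutionOn_twoHalf` (the residual force of the ansatz is `(g_m, 0) ∘ π` by the two
planar equations); the force bounds (1.2) for `α ∈ (0,1)` from the convergence (1) of Theorem 3.1
(`exists_uniform_holder_bound_of_tendsto`, `Torus.eBoundedHolderNorm_twoHalf_zero_right_le`), for
`α = 0` via `α = 1/2` (`eBoundedHolderNorm_zero_le_three_mul`), continuity in the Hölder norm from
smoothness; (1.3) from (3.4) and `‖∇u_m‖² = ‖∇v_m‖² + ‖∇θ_m‖²` (`Torus.gradNormSq_twoHalf`).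
[cite: BrueDeLellisCMP2023, Thm. 1.1 p. 3, Thm. 3.1 and (3.1)–(3.4) p. 6 (arXiv:2207.06301v1)] -/
theorem brue_deLellis_anomalous_dissipation_of_thm31 (h : BrueDeLellis2023_thm31) :
    brue_deLellis_anomalous_dissipation := by
  classical
  obtain ⟨ν, g, v₀, θ₀, v, q, θ, hν, hv₀, hθ₀, hg, ⟨gLim, hlim⟩, hsol, ε, hε, hev⟩ := h
  have h01 : (0 : ℝ) < 1 := zero_lt_one
  have hU : UniqueDiffOn ℝ (Icc (0 : ℝ) 1) := uniqueDiffOn_Icc h01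
  have hNS2 : ∀ m, Torus.IsClassicalNSSolutionOn (Icc 0 1) (ν m) (g m) (v m) (q m) := fun m => (hsol m).1
  have hθ : ∀ m, Torus.IsClassicalScalarTransportOn (Icc 0 1) (ν m) (v m) (θ m) :=
    fun m => (hsol m).2.2.1
  -- the lifted objects (3.1)
  set u : ℕ → ℝ → T3 → R3 := fun m t => twoHalf (v m t) (θ m t) with hu_def
  set f : ℕ → ℝ → T3 → R3 := fun m t => twoHalf (g m t) 0 with hf_def
  set p : ℕ → ℝ → T3 → ℝ := fun m t => q m t ∘ planarProj with hp_def
  set u₀ : T3 → R3 := twoHalf v₀ θ₀ with hu₀_def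
  -- Navier–Stokes on `[0,1] × T³` with force `(g_m, 0) ∘ π`
  have hNS : ∀ m, Torus.IsClassicalNSSolutionOn (Icc 0 1) (ν m) (f m) (u m) (p m) := by
    intro m
    have h3 := Torus.isClassicalNSSolutionOn_twoHalf hU (ν m) (hNS2 m).smooth_velocity
      (hθ m).smooth_scalar (hNS2 m).smooth_pressure (hNS2 m).divFree
    refine isClassicalNSSolutionOn_congr_force_Icc h3 fun t ht x => ?_
    have hA : (fun y => Torus.timeDerivWithin (Icc 0 1) (v m) t y + Torus.convect (v m t) (v m t) y -
        ν m • Torus.laplacian (v m t) y + Torus.gradient (q m t) y) = g m t := by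
      funext y
      rw [(hNS2 m).momentum t ht y]
      abel
    have hB : (fun y => Torus.timeDerivWithin (Icc 0 1) (θ m) t y +
        ⟪v m t y, Torus.gradient (θ m t) y⟫_ℝ - ν m * Torus.laplacian (θ m t) y) =
        (0 : UnitAddTorus (Fin 2) → ℝ) := by
      funext y
      rw [(hθ m).transport t ht y]
      simp
    show Torus.twoHalfForce (Icc 0 1) (ν m) (v m) (θ m) (q m) t x = twoHalf (g m t) 0 x
    rw [Torus.twoHalfForce_apply, hA, hB]
  have hu0 : ∀ m, u m 0 = u₀ := fun m => by
    show twoHalf (v m 0) (θ m 0) = twoHalf v₀ θ₀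
    rw [(hsol m).2.1, (hsol m).2.2.2]
  have hu₀s : Torus.IsSmooth u₀ := hv₀.twoHalf hθ₀
  have hfs : ∀ m, Torus.IsSmoothSpaceTimeOn (Icc 0 1) (f m) := fun m =>
    (hg m).twoHalf (Torus.isSmoothSpaceTimeOn_const (Torus.isSmooth_const (0 : ℝ)) (Icc 0 1))
  -- the force bounds (1.2)
  have key : ∀ β : ℝ≥0, 0 < β → β < 1 →
      ∃ C : ℝ≥0∞, C < ∞ ∧ ∀ m, ∀ t ∈ Icc (0 : ℝ) 1, eBoundedHolderNorm β (g m t) ≤ C := by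
    intro β hβ0 hβ1
    obtain ⟨-, hcont, htend⟩ := hlim β hβ0 hβ1
    exact exists_uniform_holder_bound_of_tendsto isCompact_Icc hcont
      (fun m => continuousInHolderOn_of_isSmoothSpaceTimeOn h01 (hg m) hβ1) htend
  have hforce : ∀ α : ℝ≥0, α < 1 →
      (∃ C : ℝ≥0∞, C < ∞ ∧ ∀ m, ∀ t ∈ Icc (0 : ℝ) 1, eBoundedHolderNorm α (f m t) ≤ C) ∧
        ∀ m, ContinuousInHolderOn (Icc 0 1) α (f m) := by
    intro α hα1
    refine ⟨?_, fun m => continuousInHolderOn_of_isSmoothSpaceTimeOn h01 (hfs m) hα1⟩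
    by_cases hα0 : 0 < α
    · obtain ⟨C, hC, hb⟩ := key α hα0 hα1
      exact ⟨C, hC, fun m t ht =>
        (Torus.eBoundedHolderNorm_twoHalf_zero_right_le α (g m t)).trans (hb m t ht)⟩
    · have hα : α = 0 := nonpos_iff_eq_zero.1 (not_lt.1 hα0)
      subst hα
      obtain ⟨C, hC, hb⟩ := key (1 / 2) (by norm_num) (by norm_num)
      refine ⟨3 * C, ENNReal.mul_lt_top (by simp) hC, fun m t ht => ?_⟩
      calc eBoundedHolderNorm 0 (f m t)
          ≤ eBoundedHolderNorm 0 (g m t) := Torus.eBoundedHolderNorm_twoHalf_zero_right_le 0 (g m t)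
        _ ≤ 3 * eBoundedHolderNorm (1 / 2 : ℝ≥0) (g m t) := eBoundedHolderNorm_zero_le_three_mul _ _
        _ ≤ 3 * C := by
          gcongr
          exact hb m t ht
  -- the anomalous dissipation (1.3) from (3.4): `ν‖∇u‖² ≥ ν‖∇θ‖²`
  have hAD : HasAnomalousDissipation ν u := by
    refine ⟨ε, hε, hev.mono fun m hm => hm.trans ?_⟩
    have hcu : ContinuousOn (fun s => Torus.gradNormSq (u m s)) (Icc 0 1) :=
      (hNS m).smooth_velocity.continuousOn_gradNormSq (convex_Icc 0 1) hU
    have hcθ : ContinuousOn (fun s => Torus.scalarGradNormSq (θ m s)) (Icc 0 1) :=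
      (hθ m).continuousOn_scalarGradNormSq (convex_Icc 0 1) hU
    have hsub : uIcc (0 : ℝ) 1 ⊆ Icc 0 1 := by rw [uIcc_of_le zero_le_one]
    have hiu : IntervalIntegrable (fun s => Torus.gradNormSq (u m s)) volume 0 1 :=
      (hcu.mono hsub).intervalIntegrable
    have hiθ : IntervalIntegrable (fun s => Torus.scalarGradNormSq (θ m s)) volume 0 1 :=
      (hcθ.mono hsub).intervalIntegrable
    have hmono : ∫ s in (0 : ℝ)..1, Torus.scalarGradNormSq (θ m s) ≤
        ∫ s in (0 : ℝ)..1, Torus.gradNormSq (u m s) := by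
      refine intervalIntegral.integral_mono_on zero_le_one hiθ hiu fun s hs => ?_
      show Torus.scalarGradNormSq (θ m s) ≤ Torus.gradNormSq (twoHalf (v m s) (θ m s))
      rw [Torus.gradNormSq_twoHalf ((hNS2 m).smooth_velocity.isSmooth_slice hs)
        ((hθ m).smooth_scalar.isSmooth_slice hs)]
      exact le_add_of_nonneg_left (Torus.gradNormSq_nonneg _)
    unfold Torus.scalarDissipation Torus.cumulativeDissipation
    exact mul_le_mul_of_nonneg_left hmono (hν.2.2 m).le
  exact ⟨ν, u₀, f, u, p, hν, hu₀s, hfs, fun m => ⟨hNS m, hu0 m⟩, hforce, hAD⟩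

end BrueDeLellis2023

end Literature.Analysis.FluidPDE

end
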